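import Mathlib.Algebra.BigOperators.Group.Finset.Basic
import Mathlib.Algebra.Order.BigOperators.Group.Finset
import Mathlib.Data.Fintype.BigOperators
import Mathlib.Tactic
import HarnessLib

/-!
# Venture HSemireg — kernel leg of THEOREM L (W5 seat w5-n6-2 gen 17): transversal 4-cycles of a flat triangle-free four-coordinate design

Bookkeeping of the computation cell `pub-hsemireg`, group W5 (note `widen/W5/FLATTF-w5n62g17.md`,
scripts `widen/W5/n6code2/v20/flattf/`). A *flat four-coordinate design* in the sense of
`widen/W5/N7-FEASIBILITY-w5n7.md` §3.9 is: four level sets `A, B, C, D` with `t` levels each and six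
bipartite «torus» graphs, one for each pair of coordinates, every level having exactly `d` neighbours
in each of the three graphs it belongs to. Here the graphs are given by neighbourhood maps
`nXY : X → Finset Y` together with their transposes `nYX` (`y ∈ nXY x ↔ x ∈ nYX y`). The design is
*triangle-free* when no three pairwise adjacent levels lie in three distinct coordinates.
`ΣN(C₄) = N₁ + N₂ + N₃` is the number of transversal 4-cycles (one level per coordinate) summed over
the three cyclic orders `(A B C D)`, `(A B D C)`, `(A C B D)`; we spell each `Nᵢ` as the sum, over a
level `a` and its two cycle-neighbours, of the number of common neighbours closing the cycle.

* `sum_card_inter_comm` — double counting of adjacent pairs between two finite sets;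
* `box_bound` — LEMMA 1 + LEMMA 2 of the note for ONE torus: if `S₁ ⊔ S₂ ⊆ Y` and `K₁ ⊔ K₂ ⊆ W` are
  pairs of disjoint `d`-sets in a `d`-biregular bipartite graph `Y – W` on `t + t` levels whose
  «diagonal blocks» `S₁ × K₁`, `S₂ × K₂` carry no edge, then
  `4 d² ≤ e(S₂, K₁) + e(S₁, K₂) + d t`;
* `twelve_mul_le` — **THEOREM L**: `12 t d³ ≤ 2 ΣN(C₄) + 3 t² d²`, i.e. `ΣN(C₄) ≥ (3/2) t d² (4d − t)`;
* `fourCycles_ne_ksecant_value` — COROLLARY: for `2d < t` and `2t ≤ 7d` (the window of the note,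
  where the K-secant value `t d² (7d − 2t)` of N7F §3.9 (b) is a natural number),
  `ΣN(C₄) ≠ t d² (7d − 2t)`.

HONEST FRAMING: finite combinatorics (double counting and inclusion–exclusion on finite sets) and
natural-number arithmetic only. The identification of these hypotheses with the cell's «flat
triangle-free K-secant coordinate skeleta» and of `t d² (7d − 2t)` with the `|S| = 4` class equation
lives in the notes (N7-FEASIBILITY §3.8–3.9, FLATTF-w5n62g17 §0), not here. Nothing in this file says
that HC, HC_CM or HC_AV holds; no door ∕ tier ∕ report sentence of the cell is a consequence of this
file alone.
-/

namespace Summit.Ventures.HSemireg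

namespace FlatTriangleFreeFourCycles

open Finset

section DoubleCounting

variable {X Y : Type*} [DecidableEq X] [DecidableEq Y]

/-- Double counting: the number of adjacent pairs `(x, y)` with `x ∈ S`, `y ∈ T` counted from the
`X` side (`y ∈ adj x`) equals the count from the `Y` side (`x ∈ adj' y`) when `adj'` is the transpose
of `adj`. -/
theorem sum_card_inter_comm (S : Finset X) (T : Finset Y) (adj : X → Finset Y) (adj' : Y → Finset X)
    (h : ∀ x y, y ∈ adj x ↔ x ∈ adj' y) :
    ∑ x ∈ S, (adj x ∩ T).card = ∑ y ∈ T, (adj' y ∩ S).card := by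
  have h1 : ∀ x, (adj x ∩ T).card = ∑ y ∈ T, if x ∈ adj' y then 1 else 0 := by
    intro x
    calc (adj x ∩ T).card = (T.filter (fun y => y ∈ adj x)).card := by
          rw [Finset.filter_mem_eq_inter, Finset.inter_comm]
      _ = (T.filter (fun y => x ∈ adj' y)).card := by
          rw [Finset.filter_congr (fun y _ => h x y)]
      _ = ∑ y ∈ T, if x ∈ adj' y then 1 else 0 := by
          rw [Finset.sum_boole, Nat.cast_id]
  have h2 : ∀ y, (adj' y ∩ S).card = ∑ x ∈ S, if x ∈ adj' y then 1 else 0 := by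
    intro y
    rw [Finset.sum_boole, Nat.cast_id, Finset.filter_mem_eq_inter, Finset.inter_comm]
  simp_rw [h1, h2]
  exact Finset.sum_comm

end DoubleCounting

section Box

variable {Y W : Type*} [Fintype W] [DecidableEq Y] [DecidableEq W]

/-- **The box bound** (LEMMA 1 + LEMMA 2 of the note, for one torus). `nYW : Y → Finset W` and its
transpose `nWY` describe a bipartite graph between the `Y`-levels and the `W`-levels (`t` of them) in
which every level has exactly `d` neighbours. If `S₁, S₂ ⊆ Y` and `K₁, K₂ ⊆ W` are disjoint pairs of
`d`-sets and no edge joins `S₁` to `K₁` nor `S₂` to `K₂` (the two «diagonal blocks» of the box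
`(S₁ ⊔ S₂) × (K₁ ⊔ K₂)` are empty), then the two «off-diagonal blocks» carry at least `4d² − dt` edges:
`4 d² ≤ e(S₂, K₁) + e(S₁, K₂) + d t`. (Proof: each of the `2d` rows of the box has `d` edges, of which
those leaving the box land in the `t − 2d` columns outside `K₁ ⊔ K₂`, which absorb at most `d` each.) -/
theorem box_bound (d t : ℕ) (hW : Fintype.card W = t)
    (nYW : Y → Finset W) (nWY : W → Finset Y) (hc : ∀ y w, w ∈ nYW y ↔ y ∈ nWY w)
    (hY : ∀ y, (nYW y).card = d) (hWd : ∀ w, (nWY w).card = d)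
    (S₁ S₂ : Finset Y) (K₁ K₂ : Finset W) (hS : Disjoint S₁ S₂) (hK : Disjoint K₁ K₂)
    (hS₁ : S₁.card = d) (hS₂ : S₂.card = d) (hK₁ : K₁.card = d) (hK₂ : K₂.card = d)
    (hd₁ : ∀ y ∈ S₁, Disjoint (nYW y) K₁) (hd₂ : ∀ y ∈ S₂, Disjoint (nYW y) K₂) :
    4 * d ^ 2 ≤ (∑ y ∈ S₂, (nYW y ∩ K₁).card) + (∑ y ∈ S₁, (nYW y ∩ K₂).card) + d * t := by
  classical
  set R : Finset W := univ \ (K₁ ∪ K₂) with hR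
  -- every finite set of `W`-levels splits along `K₁ ⊔ K₂ ⊔ R`
  have part : ∀ X : Finset W, X.card = (X ∩ K₁).card + (X ∩ K₂).card + (X ∩ R).card := by
    intro X
    have h1 : X ∩ R = X \ (K₁ ∪ K₂) := by
      ext w
      simp only [hR, mem_inter, mem_sdiff, mem_univ, true_and]
    have h2 : X ∩ (K₁ ∪ K₂) = (X ∩ K₁) ∪ (X ∩ K₂) := Finset.inter_union_distrib_left _ _ _
    have h3 : Disjoint (X ∩ K₁) (X ∩ K₂) := hK.mono inter_subset_right inter_subset_right
    have h4 : (X ∩ (K₁ ∪ K₂)).card + (X \ (K₁ ∪ K₂)).card = X.card :=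
      Finset.card_inter_add_card_sdiff X (K₁ ∪ K₂)
    rw [h2, Finset.card_union_of_disjoint h3] at h4
    rw [h1]
    omega
  -- rows in `S₁`: the `d` edges go to `K₂` or to `R`
  have rowS₁ : ∀ y ∈ S₁, (nYW y ∩ K₂).card + (nYW y ∩ R).card = d := by
    intro y hy
    have hp := part (nYW y)
    rw [hY y, Finset.disjoint_iff_inter_eq_empty.mp (hd₁ y hy), Finset.card_empty] at hp
    omega
  -- rows in `S₂`: the `d` edges go to `K₁` or to `R`
  have rowS₂ : ∀ y ∈ S₂, (nYW y ∩ K₁).card + (nYW y ∩ R).card = d := by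
    intro y hy
    have hp := part (nYW y)
    rw [hY y, Finset.disjoint_iff_inter_eq_empty.mp (hd₂ y hy), Finset.card_empty] at hp
    omega
  have sumS₁ : (∑ y ∈ S₁, (nYW y ∩ K₂).card) + (∑ y ∈ S₁, (nYW y ∩ R).card) = d * d := by
    rw [← Finset.sum_add_distrib, Finset.sum_congr rfl (fun y hy => rowS₁ y hy), Finset.sum_const,
      hS₁, smul_eq_mul]
  have sumS₂ : (∑ y ∈ S₂, (nYW y ∩ K₁).card) + (∑ y ∈ S₂, (nYW y ∩ R).card) = d * d := by
    rw [← Finset.sum_add_distrib, Finset.sum_congr rfl (fun y hy => rowS₂ y hy), Finset.sum_const,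
      hS₂, smul_eq_mul]
  -- the edges leaving the box are absorbed by the columns of `R`, at most `d` each
  have restle : (∑ y ∈ S₁, (nYW y ∩ R).card) + (∑ y ∈ S₂, (nYW y ∩ R).card) ≤ R.card * d := by
    rw [← Finset.sum_union hS]
    calc ∑ y ∈ S₁ ∪ S₂, (nYW y ∩ R).card
        ≤ ∑ y ∈ (S₁ ∪ S₂) ∪ (R.biUnion nWY), (nYW y ∩ R).card :=
          Finset.sum_le_sum_of_subset (Finset.subset_union_left)
      _ = ∑ w ∈ R, (nWY w ∩ ((S₁ ∪ S₂) ∪ (R.biUnion nWY))).card :=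
          sum_card_inter_comm _ _ nYW nWY hc
      _ = ∑ w ∈ R, d := by
          refine Finset.sum_congr rfl (fun w hw => ?_)
          have hsub : nWY w ⊆ (S₁ ∪ S₂) ∪ (R.biUnion nWY) :=
            fun y hy => Finset.mem_union_right _ (Finset.mem_biUnion.mpr ⟨w, hw, hy⟩)
          rw [Finset.inter_eq_left.mpr hsub, hWd w]
      _ = R.card * d := by rw [Finset.sum_const, smul_eq_mul]
  -- `R` has `t − 2d` columns
  have hKU : (K₁ ∪ K₂).card = 2 * d := by
    rw [Finset.card_union_of_disjoint hK, hK₁, hK₂]; ring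
  have hRcard : R.card + 2 * d = t := by
    have h1 : R.card = (univ : Finset W).card - (K₁ ∪ K₂).card := by
      rw [hR, Finset.card_sdiff, Finset.inter_univ]
    have h2 : (K₁ ∪ K₂).card ≤ (univ : Finset W).card := Finset.card_le_univ _
    rw [Finset.card_univ, hW] at h1 h2
    omega
  -- arithmetic
  obtain ⟨r, hr⟩ : ∃ r, R.card = r := ⟨_, rfl⟩
  rw [hr] at restle hRcard
  have ht : t = r + 2 * d := by omega
  subst ht
  nlinarith [sumS₁, sumS₂, restle]

end Box

section Design

variable {α β γ δ : Type*} [Fintype α] [Fintype γ] [Fintype δ]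
  [DecidableEq β] [DecidableEq γ] [DecidableEq δ]

/-- **THEOREM L** (FLATTF-w5n62g17 §0–§3). In a flat triangle-free four-coordinate design with `t`
levels of margin `d` on every coordinate, the transversal 4-cycles summed over the three cyclic orders
satisfy `12 t d³ ≤ 2 ΣN(C₄) + 3 t² d²`, i.e. `ΣN(C₄) ≥ (3/2) t d² (4d − t)`. The three sums are
`N₁` = cycles `a – b – c – e – a` of order `(A B C D)` (a level `a`, its neighbours `b ∈ nAB a`,
`e ∈ nAD a`, a common neighbour `c ∈ nBC b ∩ nDC e`), `N₂` = cycles `a – b – e – c – a` of order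
`(A B D C)` (`e ∈ nBD b ∩ nCD c`), `N₃` = cycles `a – c – b – e – a` of order `(A C B D)`
(`b ∈ nCB c ∩ nDB e`); each transversal 4-cycle is counted exactly once, in its own order. The nine
neighbourhood maps are the six torus graphs seen from `A` resp. from both ends for `BC, BD, CD`
(`cXY` = transposition), `rXY` are the flat margins `d`, `tXYZ` is triangle-freeness on the four
triples. (The transposes at `A`, their margins and `|B| = t` are part of the design but are not
used by the bound, so they are not assumed.) -/
theorem twelve_mul_le (d t : ℕ)
    (hα : Fintype.card α = t) (hγ : Fintype.card γ = t) (hδ : Fintype.card δ = t)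
    (nAB : α → Finset β) (nAC : α → Finset γ) (nAD : α → Finset δ)
    (nBC : β → Finset γ) (nCB : γ → Finset β) (nBD : β → Finset δ) (nDB : δ → Finset β)
    (nCD : γ → Finset δ) (nDC : δ → Finset γ)
    (cBC : ∀ b c, c ∈ nBC b ↔ b ∈ nCB c) (cBD : ∀ b e, e ∈ nBD b ↔ b ∈ nDB e)
    (cCD : ∀ c e, e ∈ nCD c ↔ c ∈ nDC e)
    (rAB : ∀ a, (nAB a).card = d) (rAC : ∀ a, (nAC a).card = d) (rAD : ∀ a, (nAD a).card = d)
    (rBC : ∀ b, (nBC b).card = d) (rCB : ∀ c, (nCB c).card = d) (rBD : ∀ b, (nBD b).card = d)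
    (rDB : ∀ e, (nDB e).card = d) (rCD : ∀ c, (nCD c).card = d) (rDC : ∀ e, (nDC e).card = d)
    (tABC : ∀ a b c, b ∈ nAB a → c ∈ nBC b → c ∉ nAC a)
    (tABD : ∀ a b e, b ∈ nAB a → e ∈ nBD b → e ∉ nAD a)
    (tACD : ∀ a c e, c ∈ nAC a → e ∈ nCD c → e ∉ nAD a)
    (tBCD : ∀ b c e, c ∈ nBC b → e ∈ nCD c → e ∉ nBD b) :
    12 * t * d ^ 3 ≤
      2 * ((∑ a, ∑ b ∈ nAB a, ∑ e ∈ nAD a, (nBC b ∩ nDC e).card) + (∑ a, ∑ b ∈ nAB a, ∑ c ∈ nAC a, (nBD b ∩ nCD c).card) + (∑ a, ∑ c ∈ nAC a, ∑ e ∈ nAD a, (nCB c ∩ nDB e).card))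
        + 3 * t ^ 2 * d ^ 2 := by
  classical
  -- matching {AB, CD}: boxes in C × D over the AB-tori
  have key₁ : ∀ a, ∀ b ∈ nAB a,
      4 * d ^ 2 ≤ (∑ e ∈ nAD a, (nBC b ∩ nDC e).card) + (∑ c ∈ nAC a, (nBD b ∩ nCD c).card)
        + d * t := by
    intro a b hb
    have hS : Disjoint (nAC a) (nBC b) :=
      Finset.disjoint_left.mpr (fun c hca hcb => tABC a b c hb hcb hca)
    have hK : Disjoint (nAD a) (nBD b) :=
      Finset.disjoint_left.mpr (fun e hea heb => tABD a b e hb heb hea)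
    have hd₁ : ∀ c ∈ nAC a, Disjoint (nCD c) (nAD a) := fun c hc =>
      Finset.disjoint_left.mpr (fun e hec hea => tACD a c e hc hec hea)
    have hd₂ : ∀ c ∈ nBC b, Disjoint (nCD c) (nBD b) := fun c hc =>
      Finset.disjoint_left.mpr (fun e hec heb => tBCD b c e hc hec heb)
    have hbox := box_bound d t hδ nCD nDC cCD rCD rDC (nAC a) (nBC b) (nAD a) (nBD b) hS hK
      (rAC a) (rBC b) (rAD a) (rBD b) hd₁ hd₂
    have e1 : ∑ c ∈ nBC b, (nCD c ∩ nAD a).card = ∑ e ∈ nAD a, (nBC b ∩ nDC e).card := by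
      rw [sum_card_inter_comm (nBC b) (nAD a) nCD nDC cCD]
      exact Finset.sum_congr rfl (fun e _ => by rw [Finset.inter_comm])
    have e2 : ∑ c ∈ nAC a, (nCD c ∩ nBD b).card = ∑ c ∈ nAC a, (nBD b ∩ nCD c).card :=
      Finset.sum_congr rfl (fun c _ => by rw [Finset.inter_comm])
    rw [e1, e2] at hbox
    exact hbox
  have m₁ : t * d * (4 * d ^ 2) ≤
      (∑ a, ∑ b ∈ nAB a, ∑ e ∈ nAD a, (nBC b ∩ nDC e).card) + (∑ a, ∑ b ∈ nAB a, ∑ c ∈ nAC a, (nBD b ∩ nCD c).card) + t * d * (d * t) := by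
    have hsum := Finset.sum_le_sum (s := (univ : Finset α))
      (fun a _ => Finset.sum_le_sum (fun b hb => key₁ a b hb))
    have lhs : ∑ a ∈ (univ : Finset α), ∑ b ∈ nAB a, 4 * d ^ 2 = t * d * (4 * d ^ 2) := by
      simp only [Finset.sum_const, smul_eq_mul, rAB, Finset.card_univ, hα]; ring
    have rhs : ∑ a ∈ (univ : Finset α), ∑ b ∈ nAB a,
        ((∑ e ∈ nAD a, (nBC b ∩ nDC e).card) + (∑ c ∈ nAC a, (nBD b ∩ nCD c).card) + d * t)
        = (∑ a, ∑ b ∈ nAB a, ∑ e ∈ nAD a, (nBC b ∩ nDC e).card) + (∑ a, ∑ b ∈ nAB a, ∑ c ∈ nAC a, (nBD b ∩ nCD c).card) + t * d * (d * t) := by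
      simp only [Finset.sum_add_distrib, Finset.sum_const, smul_eq_mul, rAB, Finset.card_univ, hα]
      ring
    rw [lhs, rhs] at hsum
    exact hsum
  -- matching {AC, BD}: boxes in B × D over the AC-tori
  have key₂ : ∀ a, ∀ c ∈ nAC a,
      4 * d ^ 2 ≤ (∑ e ∈ nAD a, (nCB c ∩ nDB e).card) + (∑ b ∈ nAB a, (nBD b ∩ nCD c).card)
        + d * t := by
    intro a c hc
    have hS : Disjoint (nAB a) (nCB c) :=
      Finset.disjoint_left.mpr (fun b hba hbc => tABC a b c hba ((cBC b c).mpr hbc) hc)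
    have hK : Disjoint (nAD a) (nCD c) :=
      Finset.disjoint_left.mpr (fun e hea hec => tACD a c e hc hec hea)
    have hd₁ : ∀ b ∈ nAB a, Disjoint (nBD b) (nAD a) := fun b hb =>
      Finset.disjoint_left.mpr (fun e heb hea => tABD a b e hb heb hea)
    have hd₂ : ∀ b ∈ nCB c, Disjoint (nBD b) (nCD c) := fun b hb =>
      Finset.disjoint_left.mpr (fun e heb hec => tBCD b c e ((cBC b c).mpr hb) hec heb)
    have hbox := box_bound d t hδ nBD nDB cBD rBD rDB (nAB a) (nCB c) (nAD a) (nCD c) hS hK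
      (rAB a) (rCB c) (rAD a) (rCD c) hd₁ hd₂
    have e1 : ∑ b ∈ nCB c, (nBD b ∩ nAD a).card = ∑ e ∈ nAD a, (nCB c ∩ nDB e).card := by
      rw [sum_card_inter_comm (nCB c) (nAD a) nBD nDB cBD]
      exact Finset.sum_congr rfl (fun e _ => by rw [Finset.inter_comm])
    rw [e1] at hbox
    exact hbox
  have m₂ : t * d * (4 * d ^ 2) ≤
      (∑ a, ∑ c ∈ nAC a, ∑ e ∈ nAD a, (nCB c ∩ nDB e).card) + (∑ a, ∑ b ∈ nAB a, ∑ c ∈ nAC a, (nBD b ∩ nCD c).card) + t * d * (d * t) := by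
    have hsum := Finset.sum_le_sum (s := (univ : Finset α))
      (fun a _ => Finset.sum_le_sum (fun c hc => key₂ a c hc))
    have lhs : ∑ a ∈ (univ : Finset α), ∑ c ∈ nAC a, 4 * d ^ 2 = t * d * (4 * d ^ 2) := by
      simp only [Finset.sum_const, smul_eq_mul, rAC, Finset.card_univ, hα]; ring
    have rhs : ∑ a ∈ (univ : Finset α), ∑ c ∈ nAC a,
        ((∑ e ∈ nAD a, (nCB c ∩ nDB e).card) + (∑ b ∈ nAB a, (nBD b ∩ nCD c).card) + d * t)
        = (∑ a, ∑ c ∈ nAC a, ∑ e ∈ nAD a, (nCB c ∩ nDB e).card) + (∑ a, ∑ b ∈ nAB a, ∑ c ∈ nAC a, (nBD b ∩ nCD c).card) + t * d * (d * t) := by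
      simp only [Finset.sum_add_distrib, Finset.sum_const, smul_eq_mul, rAC, Finset.card_univ, hα]
      have hswap : ∀ a : α, ∑ c ∈ nAC a, ∑ b ∈ nAB a, (nBD b ∩ nCD c).card
          = ∑ b ∈ nAB a, ∑ c ∈ nAC a, (nBD b ∩ nCD c).card := fun a => Finset.sum_comm
      simp_rw [hswap]
      ring
    rw [lhs, rhs] at hsum
    exact hsum
  -- matching {AD, BC}: boxes in B × C over the AD-tori
  have key₃ : ∀ a, ∀ e ∈ nAD a,
      4 * d ^ 2 ≤ (∑ c ∈ nAC a, (nCB c ∩ nDB e).card) + (∑ b ∈ nAB a, (nBC b ∩ nDC e).card)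
        + d * t := by
    intro a e he
    have hS : Disjoint (nAB a) (nDB e) :=
      Finset.disjoint_left.mpr (fun b hba hbe => tABD a b e hba ((cBD b e).mpr hbe) he)
    have hK : Disjoint (nAC a) (nDC e) :=
      Finset.disjoint_left.mpr (fun c hca hce => tACD a c e hca ((cCD c e).mpr hce) he)
    have hd₁ : ∀ b ∈ nAB a, Disjoint (nBC b) (nAC a) := fun b hb =>
      Finset.disjoint_left.mpr (fun c hcb hca => tABC a b c hb hcb hca)
    have hd₂ : ∀ b ∈ nDB e, Disjoint (nBC b) (nDC e) := fun b hb =>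
      Finset.disjoint_left.mpr (fun c hcb hce =>
        tBCD b c e hcb ((cCD c e).mpr hce) ((cBD b e).mpr hb))
    have hbox := box_bound d t hγ nBC nCB cBC rBC rCB (nAB a) (nDB e) (nAC a) (nDC e) hS hK
      (rAB a) (rDB e) (rAC a) (rDC e) hd₁ hd₂
    have e1 : ∑ b ∈ nDB e, (nBC b ∩ nAC a).card = ∑ c ∈ nAC a, (nCB c ∩ nDB e).card := by
      rw [sum_card_inter_comm (nDB e) (nAC a) nBC nCB cBC]
    rw [e1] at hbox
    exact hbox
  have m₃ : t * d * (4 * d ^ 2) ≤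
      (∑ a, ∑ c ∈ nAC a, ∑ e ∈ nAD a, (nCB c ∩ nDB e).card) + (∑ a, ∑ b ∈ nAB a, ∑ e ∈ nAD a, (nBC b ∩ nDC e).card) + t * d * (d * t) := by
    have hsum := Finset.sum_le_sum (s := (univ : Finset α))
      (fun a _ => Finset.sum_le_sum (fun e he => key₃ a e he))
    have lhs : ∑ a ∈ (univ : Finset α), ∑ e ∈ nAD a, 4 * d ^ 2 = t * d * (4 * d ^ 2) := by
      simp only [Finset.sum_const, smul_eq_mul, rAD, Finset.card_univ, hα]; ring
    have rhs : ∑ a ∈ (univ : Finset α), ∑ e ∈ nAD a,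
        ((∑ c ∈ nAC a, (nCB c ∩ nDB e).card) + (∑ b ∈ nAB a, (nBC b ∩ nDC e).card) + d * t)
        = (∑ a, ∑ c ∈ nAC a, ∑ e ∈ nAD a, (nCB c ∩ nDB e).card) + (∑ a, ∑ b ∈ nAB a, ∑ e ∈ nAD a, (nBC b ∩ nDC e).card) + t * d * (d * t) := by
      simp only [Finset.sum_add_distrib, Finset.sum_const, smul_eq_mul, rAD, Finset.card_univ, hα]
      have hswap₁ : ∀ a : α, ∑ e ∈ nAD a, ∑ c ∈ nAC a, (nCB c ∩ nDB e).card
          = ∑ c ∈ nAC a, ∑ e ∈ nAD a, (nCB c ∩ nDB e).card := fun a => Finset.sum_comm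
      have hswap₂ : ∀ a : α, ∑ e ∈ nAD a, ∑ b ∈ nAB a, (nBC b ∩ nDC e).card
          = ∑ b ∈ nAB a, ∑ e ∈ nAD a, (nBC b ∩ nDC e).card := fun a => Finset.sum_comm
      simp_rw [hswap₁, hswap₂]
      ring
    rw [lhs, rhs] at hsum
    exact hsum
  nlinarith [m₁, m₂, m₃]

/-- **COROLLARY** (the all-`(d, t)` statement of N7F §3.9 (d) ∕ TABLE-W5-N7 row N7-17). In the window
`2d < t`, `2t ≤ 7d` the K-secant value `t d² (7d − 2t)` of the `|S| = 4` class equation for flat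
triangle-free designs (N7F §3.9 (b)) is never the transversal 4-cycle count: it falls short of the
THEOREM L bound by `½ t d² (t − 2d) > 0`. -/
theorem fourCycles_ne_ksecant_value (d t : ℕ) (h2d : 2 * d < t) (h7d : 2 * t ≤ 7 * d)
    (hα : Fintype.card α = t) (hγ : Fintype.card γ = t) (hδ : Fintype.card δ = t)
    (nAB : α → Finset β) (nAC : α → Finset γ) (nAD : α → Finset δ)
    (nBC : β → Finset γ) (nCB : γ → Finset β) (nBD : β → Finset δ) (nDB : δ → Finset β)
    (nCD : γ → Finset δ) (nDC : δ → Finset γ)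
    (cBC : ∀ b c, c ∈ nBC b ↔ b ∈ nCB c) (cBD : ∀ b e, e ∈ nBD b ↔ b ∈ nDB e)
    (cCD : ∀ c e, e ∈ nCD c ↔ c ∈ nDC e)
    (rAB : ∀ a, (nAB a).card = d) (rAC : ∀ a, (nAC a).card = d) (rAD : ∀ a, (nAD a).card = d)
    (rBC : ∀ b, (nBC b).card = d) (rCB : ∀ c, (nCB c).card = d) (rBD : ∀ b, (nBD b).card = d)
    (rDB : ∀ e, (nDB e).card = d) (rCD : ∀ c, (nCD c).card = d) (rDC : ∀ e, (nDC e).card = d)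
    (tABC : ∀ a b c, b ∈ nAB a → c ∈ nBC b → c ∉ nAC a)
    (tABD : ∀ a b e, b ∈ nAB a → e ∈ nBD b → e ∉ nAD a)
    (tACD : ∀ a c e, c ∈ nAC a → e ∈ nCD c → e ∉ nAD a)
    (tBCD : ∀ b c e, c ∈ nBC b → e ∈ nCD c → e ∉ nBD b) :
    (∑ a, ∑ b ∈ nAB a, ∑ e ∈ nAD a, (nBC b ∩ nDC e).card) + (∑ a, ∑ b ∈ nAB a, ∑ c ∈ nAC a, (nBD b ∩ nCD c).card) + (∑ a, ∑ c ∈ nAC a, ∑ e ∈ nAD a, (nCB c ∩ nDB e).card)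
      ≠ t * d ^ 2 * (7 * d - 2 * t) := by
  intro hN
  have hL := twelve_mul_le d t hα hγ hδ nAB nAC nAD nBC nCB nBD nDB nCD nDC cBC cBD cCD
    rAB rAC rAD rBC rCB rBD rDB rCD rDC tABC tABD tACD tBCD
  rw [hN] at hL
  obtain ⟨k, hk⟩ : ∃ k, 7 * d = 2 * t + k := ⟨7 * d - 2 * t, by omega⟩
  have hk' : 7 * d - 2 * t = k := by omega
  rw [hk'] at hL
  have hd : 0 < d := by
    rcases Nat.eq_zero_or_pos d with h | h
    · subst h; omega
    · exact h
  have ht : 0 < t := by omega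
  -- `hL : 12 t d³ ≤ 2 t d² k + 3 t² d²`, i.e. `t d² · 12 d ≤ t d² · (2k + 3t)`
  have hL' : t * d ^ 2 * (12 * d) ≤ t * d ^ 2 * (2 * k + 3 * t) := by nlinarith [hL]
  have hpos : 0 < t * d ^ 2 := by positivity
  have h12 : 12 * d ≤ 2 * k + 3 * t := Nat.le_of_mul_le_mul_left hL' hpos
  omega

end Design

end FlatTriangleFreeFourCycles

end Summit.Ventures.HSemireg
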